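import Literature.NumberTheory.Automorphic.TotallyRealModularityQuarticSixteenCurves
import Literature.NumberTheory.GaloisRepresentations.SerreProp19GL2Fp
import Summits.Langlands.Langlands.Theorems.SqrtFiveQuarticCoversTraceDetTablesThree

/-!
# «Large at 5» ⇒ modular over ANY totally real field, modulo FLS Thm 3 alone — the fact-minimal
# `ℓ = 5` form of the E11 bridge (route `SqrtFiveQuarticCovers`, cell `pub/lg-quartmod`, F-L1)

Companion of `SqrtFiveQuarticCoversFrobeniusWitnessModularity` (§4 there: the fact-minimal forms at
`ℓ = 3` and `ℓ = 7`).  At `ℓ = 5` the tree proves, from `FLS2015_theorem3` alone and over ANY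
totally real `K` (no degree or `√5` hypothesis), that a non-modular `E / 𝓞 K` has SOME framing of
`E[5]` with image in the Borel subgroup, or in the normaliser of a split Cartan subgroup
`Serre1972.splitCartan P`, or in the normaliser of a non-split Cartan subgroup
`Serre1972.unitGroup k` (`Box2022.clause_five` = FLS Thm 3 at `p = 5` + Prop. 3.1 (ii) / Lemma
3.2).  Serre's §2.8 observation (tree: `Serre1972.false_of_le_normalizer_cartan`) kills both
Cartan normalisers with two elements of non-zero trace, one of non-zero SQUARE discriminant
`trace² − 4 det` and one of NON-SQUARE discriminant (the cell's flags `W5s`, `W5ns`); the second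
also kills the Borel (`not_conj_borel_of_witness`, flag `W5b`).  Hence:

* `isModularEllipticCurve_of_witnesses_five_of_isTotallyReal (h3 : FLS2015_theorem3)` — for `K`
  totally real (any degree), `E / 𝓞 K` with `Δ ≠ 0`: if every framing `ρ̄` of `E[5]` has some
  `ρ̄(σ)` with `trace ≠ 0` and `trace² − 4 det` a non-zero square, and some `ρ̄(σ')` with
  `trace ≠ 0` and `trace² − 4 det` a non-square, then `IsModularEllipticCurve K E`.

Inside F-L1 (`√5 ∈ K`, quartic) the `H8 / H12` rows of the companion file are what the route uses;
this form serves fields without `√5` or of other degrees.  CONDITIONAL on the named fact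
`FLS2015_theorem3` (cited, not proved); glue only, no definitions, standard axioms.  HONEST:
nothing here proves modularity of any particular curve — the dictionary
`(N𝔓, a_𝔓) ↦ (det, trace)` of `ρ̄_{E,5}(Frob_𝔓)` is the user's computational input.
References: [FreitasLeHungSiksek2015] Thm 3, Prop. 3.1 (ii); [Serre1972] §2.8 (proof of Prop. 19);
[Box2022] Thm 7.1.
-/

set_option linter.dupNamespace false -- project-wide option (lakefile weak.linter.dupNamespace); `Summit.Langlands.Langlands` is the mandated namespace

namespace Summit.Langlands.Langlands.Theorems.SqrtFiveQuarticCovers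

open scoped Matrix NumberField
open Literature.NumberTheory.Automorphic Literature.NumberTheory.GaloisRepresentations

/-- **«Large at 5» ⇒ modular over ANY totally real field, modulo FLS Thm 3 alone** (Serre's
conditions i) + ii) of Prop. 19 at `p = 5` on every framing): `K` totally real, `E / 𝓞 K` with
`Δ ≠ 0`; if for every framing `ρ̄` of `E[5]` there are `σ, σ'` with `trace ρ̄(σ) ≠ 0`,
`trace² − 4 det` of `ρ̄(σ)` a non-zero square, `trace ρ̄(σ') ≠ 0` and `trace² − 4 det` of `ρ̄(σ')`
a non-square, then `E` is modular.  Proof: `Box2022.clause_five h3` (Borel ∨ N(C_s) ∨ N(C_ns) for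
some framing of a non-modular curve), `not_conj_borel_of_witness` and
`Serre1972.false_of_le_normalizer_cartan`. [cite: FreitasLeHungSiksek2015, Thm. 3 and Prop. 3.1 (ii)] [cite: Serre1972, §2.8] -/
theorem isModularEllipticCurve_of_witnesses_five_of_isTotallyReal (h3 : FLS2015_theorem3) :
    ∀ (K : Type) [Field K] [NumberField K], NumberField.IsTotallyReal K →
      ∀ E : WeierstrassCurve (NumberField.RingOfIntegers K), E.Δ ≠ 0 →
      (∀ ρ : FramedGaloisRep K (ZMod 5) 2,
        (∃ e : (E.baseChange K).geomTorsion ((5 : ℕ) : ℤ) ≃+ (Fin 2 → ZMod 5),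
          ∀ (σ : Field.absoluteGaloisGroup K) (P : (E.baseChange K).geomTorsion ((5 : ℕ) : ℤ)),
            e (σ • P) = ((ρ σ : GL (Fin 2) (ZMod 5)) : Matrix (Fin 2) (Fin 2) (ZMod 5)) *ᵥ (e P)) →
        (∃ σ : Field.absoluteGaloisGroup K,
          IsSquare (Matrix.trace ((ρ σ : GL (Fin 2) (ZMod 5)) : Matrix (Fin 2) (Fin 2) (ZMod 5)) ^ 2 -
            4 * Matrix.det ((ρ σ : GL (Fin 2) (ZMod 5)) : Matrix (Fin 2) (Fin 2) (ZMod 5))) ∧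
          Matrix.trace ((ρ σ : GL (Fin 2) (ZMod 5)) : Matrix (Fin 2) (Fin 2) (ZMod 5)) ^ 2 -
            4 * Matrix.det ((ρ σ : GL (Fin 2) (ZMod 5)) : Matrix (Fin 2) (Fin 2) (ZMod 5)) ≠ 0 ∧
          Matrix.trace ((ρ σ : GL (Fin 2) (ZMod 5)) : Matrix (Fin 2) (Fin 2) (ZMod 5)) ≠ 0) ∧
        (∃ σ : Field.absoluteGaloisGroup K,
          ¬ IsSquare (Matrix.trace ((ρ σ : GL (Fin 2) (ZMod 5)) : Matrix (Fin 2) (Fin 2) (ZMod 5)) ^ 2 -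
            4 * Matrix.det ((ρ σ : GL (Fin 2) (ZMod 5)) : Matrix (Fin 2) (Fin 2) (ZMod 5))) ∧
          Matrix.trace ((ρ σ : GL (Fin 2) (ZMod 5)) : Matrix (Fin 2) (Fin 2) (ZMod 5)) ≠ 0)) →
      IsModularEllipticCurve K E := by
  intro K _ _ hK E hE hw
  haveI := hK
  haveI : Fact (Nat.Prime 5) := ⟨by norm_num⟩
  by_contra hne
  obtain ⟨ρ, hρ, hcl⟩ := Box2022.clause_five h3 K E hE
    (not_isAutomorphicOfWeightZero_of_not_isModularEllipticCurve hE hne)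
  obtain ⟨⟨σ, hsq, hD0, ht⟩, σ', hns', ht'⟩ := hw ρ hρ
  -- the two Serre witnesses, as elements of the image `G = range ρ̄`
  have hi : ∃ s ∈ ρ.toMonoidHom.range,
      (IsSquare ((s : Matrix (Fin 2) (Fin 2) (ZMod 5)).trace ^ 2 -
          4 * (s : Matrix (Fin 2) (Fin 2) (ZMod 5)).det) ∧
        (s : Matrix (Fin 2) (Fin 2) (ZMod 5)).trace ^ 2 -
          4 * (s : Matrix (Fin 2) (Fin 2) (ZMod 5)).det ≠ 0) ∧
      (s : Matrix (Fin 2) (Fin 2) (ZMod 5)).trace ≠ 0 := ⟨ρ σ, ⟨σ, rfl⟩, ⟨hsq, hD0⟩, ht⟩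
  have hii : ∃ s' ∈ ρ.toMonoidHom.range,
      ¬ IsSquare ((s' : Matrix (Fin 2) (Fin 2) (ZMod 5)).trace ^ 2 -
        4 * (s' : Matrix (Fin 2) (Fin 2) (ZMod 5)).det) ∧
      (s' : Matrix (Fin 2) (Fin 2) (ZMod 5)).trace ≠ 0 := ⟨ρ σ', ⟨σ', rfl⟩, hns', ht'⟩
  rcases hcl with hB | ⟨P, hP⟩ | ⟨k, hk, hk2, hN⟩
  · -- Borel: the non-square discriminant of `ρ̄(σ')`
    refine not_conj_borel_of_witness (G := ρ.toMonoidHom.range) (g := ρ σ') ⟨σ', rfl⟩ hns' ⟨1, ?_⟩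
    rintro _ ⟨τ, rfl⟩; rw [one_mul, inv_one, mul_one]; exact hB τ
  · -- normaliser of a split Cartan subgroup
    refine Serre1972.false_of_le_normalizer_cartan (p := 5) (by decide)
      (Serre1972.splitCartan_mem_cartanSubgroups P) ?_ hi hii
    rintro _ ⟨τ, rfl⟩; exact hP τ
  · -- normaliser of a non-split Cartan subgroup
    refine Serre1972.false_of_le_normalizer_cartan (p := 5) (by decide)
      (C := Serre1972.unitGroup k) (Or.inr ⟨k, hk, hk2, rfl⟩) ?_ hi hii
    rintro _ ⟨τ, rfl⟩; exact hN τ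

end Summit.Langlands.Langlands.Theorems.SqrtFiveQuarticCovers
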